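import Summits.AtomisticToContinuum.BoseEinsteinCondensation.Theorems.BECGroundStateSOSLatticeODLROOffHalfFillingLadderGlue
import Summits.AtomisticToContinuum.BoseEinsteinCondensation.Theorems.BECGroundStateSOSLatticeODLROOffHalfFillingStubTwistTraceNonneg
import Summits.AtomisticToContinuum.BoseEinsteinCondensation.Theorems.BECGroundStateSOSLatticeODLROOffHalfFillingStubTwistNonnegOfTrace
import Summits.AtomisticToContinuum.BoseEinsteinCondensation.Theorems.BECGroundStateSOSLatticeODLROOffHalfFillingStubGroundSectorOfTwist
import Literature.MathematicalPhysics.QuantumLattice.FinDimSpectrumGibbsLimitProofs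

/-!
# Crux `LatticeODLROOffHalfFilling` — the ladder line: GroundSectorUnique

Route BECGroundStateSOS, crux stmt-AtomisticToContinuum-11033, line `Sketch` (gen-1 lead). Supports the crux (it is the
half-filled ANCHOR of every K1 of the ladder family that compares against half filling: MONO, Casimir).

**GroundSectorUnique.** On even tori of side `L ≥ 4` every ground vector of the `μ = 0` spin-½ XY Hamiltonian
`H_{L,0} = −Σ_{⟨xy⟩}(S¹_xS¹_y + S²_xS²_y)` is half filled (`S³_tot v = 0`); with Perron–Frobenius in the sector the ground
state is then unique. Assembled from the three landed stubs

* `stub_twistTraceNonneg` — decorated Dyson–Lieb–Simon positivity `Tr[(W⊗W̄)e^{A⊗1+1⊗Ā+ΣMᵢ⊗M̄ᵢ}] ≥ 0`;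
* `stub_twistNonneg_of_trace` — reflection positivity of the twisted partition function,
  `Re Tr(e^{−βH_{L,0}} e^{iθS³_tot}) ≥ 0` for `β ≥ 0`, `θ ∈ ℝ`;
* `stub_groundSector_of_twist` — `Re ω₀(e^{iθS³_tot}) ≥ 0 ∀θ` ⇒ ground vectors are half filled (Perron–Frobenius per
  sector and rigidity of nonnegative `{0,1}`-trigonometric polynomials),

glued here by the zero-temperature limit of the Gibbs state (`Matrix.tendsto_gibbsState_atTop_holds`). This is the XY
analogue of the Lieb–Mattis / Lieb–Schupp "the ground state is a singlet" statements; the positive-definiteness of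
`M ↦ Z_M(β)` behind it was pointed out by triage-2 of this crux. All [folklore].
-/

noncomputable section

namespace Summit.AtomisticToContinuum.BoseEinsteinCondensation.Theorems.LatticeODLROOffHalfFilling.Ladder

open Literature.MathematicalPhysics.QuantumLattice Literature.Probability.LatticeModels Matrix Finset Filter
open Summit.AtomisticToContinuum.BoseEinsteinCondensation.Theorems.LatticeODLROOffHalfFilling.Negative
open scoped ComplexOrder BigOperators Kronecker

/-! ### GroundSectorUnique -/

/-- Twist positivity passes to the tracial ground state: `Re ω₀(e^{iθS³_tot}) ≥ 0` on even tori of side `L ≥ 4`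
(`β → ∞` in `stub_twistNonneg_of_trace ∘ stub_twistTraceNonneg`, via `tendsto_gibbsState_atTop_holds`). [folklore] -/
theorem twist_groundState_nonneg (L : ℕ) [NeZero L] (hL : 4 ≤ L) (hE : Even L) (θ : ℝ) :
    0 ≤ ((Hmu L 0).groundStateFunctional
      (Matrix.diagonal (fun σ : TensorIndex (TorusSite 3 L) 2 =>
        Complex.exp (Complex.I * (θ : ℂ) * ((L : ℂ) ^ 3 / 2 - (downCount σ : ℂ)))))).re := by
  set D : Op (TorusSite 3 L) 2 := Matrix.diagonal (fun σ : TensorIndex (TorusSite 3 L) 2 =>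
    Complex.exp (Complex.I * (θ : ℂ) * ((L : ℂ) ^ 3 / 2 - (downCount σ : ℂ)))) with hD
  have hH : (Hmu L 0).IsHermitian := Hmu_isHermitian L 0
  haveI : Nonempty (TensorIndex (TorusSite 3 L) 2) := ⟨fun _ => 0⟩
  have hlim := Matrix.tendsto_gibbsState_atTop_holds hH D
  have hre : Filter.Tendsto (fun β : ℝ => (Matrix.gibbsState β (Hmu L 0) D).re) Filter.atTop
      (nhds ((Hmu L 0).groundStateFunctional D).re) :=
    (Complex.continuous_re.tendsto _).comp hlim
  refine ge_of_tendsto hre ?_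
  filter_upwards [Filter.eventually_ge_atTop 0] with β hβ
  have hZ := partitionFn_pos β hH
  obtain ⟨hZre, hZim⟩ := Complex.pos_iff.mp hZ
  rw [Matrix.gibbsState_apply, Complex.mul_re, Complex.inv_re, Complex.inv_im, ← hZim]
  simp only [neg_zero, zero_div, zero_mul, sub_zero]
  refine mul_nonneg (div_nonneg hZre.le (Complex.normSq_nonneg _)) ?_
  exact stub_twistNonneg_of_trace (fun A W M => (stub_twistTraceNonneg A W M).1) L hL hE β θ hβ

/-- **GroundSectorUnique (the half-filled anchor).** On even tori of side `L ≥ 4` every ground vector of the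
`μ = 0` spin-½ XY Hamiltonian is half filled: `S³_tot v = 0`. (With Perron–Frobenius in the sector this also gives
uniqueness of the ground state; only the sector statement is needed here.) [folklore] -/
theorem groundSector_zero (L : ℕ) [NeZero L] (hL : 4 ≤ L) (hE : Even L)
    (v : TensorIndex (TorusSite 3 L) 2 → ℂ) (hv : v ∈ (Hmu L 0).groundSpace) :
    (totalSpin 1 2 : Op (TorusSite 3 L) 2) *ᵥ v = 0 :=
  stub_groundSector_of_twist L hL hE (twist_groundState_nonneg L hL hE) v hv

end Summit.AtomisticToContinuum.BoseEinsteinCondensation.Theorems.LatticeODLROOffHalfFilling.Ladder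

end
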